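import Summits.HodgeConjecture.HodgeConjecture.Theses.GmtVisibleFractionBootstrap

/-!
# Strategist line `phantom-levels` — crux `VisibleFraction` (stmt-HodgeConjecture-18330), route `GmtVisibleFractionBootstrap`

Strategist seat `planner-cstrat-stmt-HodgeConjecture-18330-s1-0` (2026-08-17). An ALTERNATIVE skeleton for
the crux `Summit.HodgeConjecture.HodgeConjecture.Theses.GmtVisibleFractionBootstrap.VisibleFraction`
(registered next to `Lines/birth.lean`, which it does not touch).

## The cut: effective levels versus phantom levels

Fix a setup `(A, S, p + q = n)` and a datum `(c₀, α)`. Call the level `k` EFFECTIVE when the class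
`k · PD[α]` is represented by an integral cycle carried by `ι(X)` that is openly holomorphic
`‖T₀‖`-almost everywhere (`‖T₀‖(hol⁺ T₀) = 𝐌(T₀)`, i.e. `k · c₀` is the class of a positive holomorphic —
hence, by Chow, algebraic — cycle), and PHANTOM otherwise.

* At an EFFECTIVE level every mass-minimizer is itself openly holomorphic a.e. (stub 2,
  `EffectiveLevelVisibility`, a THEOREM in print: the holomorphic representative is calibrated by
  `ω^q/q!`, so every minimizer has the calibrated mass, is calibrated `‖T‖`-a.e., and a closed integral
  current calibrated by a Kähler power is a positive holomorphic chain — King 1971, Harvey–Shiffman 1974,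
  Alexander; its singular set is a proper analytic subset, `‖T‖`-null). With the Wirtinger lower bound
  (stub 1, `WirtingerLowerBound` = conjunct (i) of birth's `MinimalMassAsymptotics`) this gives the crux
  inequality at effective levels with the FULL constant `κ`.
* At PHANTOM levels (the class `k · c₀` carries no positive holomorphic cycle: under HC for `c₀` these are
  exactly the Kollár-type torsion levels `k · c₀ ∉ ℤ-span of algebraic classes`; without HC, all large
  levels) the crux is the genuinely open statement `PhantomLevelVisibility` (stub 3, THE BET): minimizers
  of a class WITHOUT holomorphic representative still carry `≥ c · k · |α|` of openly-holomorphic mass.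

`VisibleFraction_of : stub 1 → stub 2 → stub 3 → VisibleFraction` is a real (sorry-free) proof: crux
constant `min κ c`, `k₀` from stub 3, case split on the level.

Why this cut (see `Lines/phantom-levels.md` and `STRATEGY-CENSUS.md` on the crux): every difficulty of
the crux lives at phantom levels, and there the census records STRUCTURE any proof must respect — a
replacement-plus-angle-criterion argument (Morgan 1982 / Lawlor 1989 tangent-cone criterion for pairs of
planes) shows that at a phantom level the openly-holomorphic part `H` of a minimizer `T = H + N` is
IMMOBILE (`[H] − [complete intersection] ∉ Eff`), so on product examples `Y × S` (Kollár threefold `Y`)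
the visible fraction is `≤ c_max < 1`: no "fraction → 1 as the calibration defect → 0" mechanism can prove
the crux, while a definite `c > 0` carried by ballast directions is consistent with everything known.

## Honesty box

* Stub 3 is implied by the crux (`phantomLevelVisibility_of_visibleFraction`, proved below): it is the
  crux RESTRICTED to the levels where it has content. Stubs 1 and 2 are theorems in print (Wirtinger;
  King–Harvey–Shiffman structure of calibrated integral cycles), not consequences of the crux (stub 2
  asserts FULL visibility at effective levels, which the crux does not).
* No stub gives the crux or the summit cheaply: stub 1 says nothing about `hol⁺`; stub 2 only speaks at
  levels that have a holomorphic representative; stub 3 only at levels that have none — the composition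
  needs the case split and both constants.
* Degenerate instances: `k · |α| ≤ 0` makes every conclusion `0 ≤ …` (handled in the proof, no positivity
  of `size` is assumed); at `k = 0` the zero current is a holomorphic representative, so level `0` is
  effective and stub 3 is never invoked there.
* Disproof used: none — `Cruxes/VisibleFraction/` has no `Disproof.lean`; `ledger negatives --problem
  HodgeConjecture` (MilnorKExponential, DerivedTorelliFermat, ELineTransport) is disjoint from GMT.
* Gate shape: the ONLY theorem concluding the crux by name is `VisibleFraction_of`; its hypotheses are
  keyed to the registered stub names through the `Registered` aliases; `sorry` occurs ONLY in the three
  `stub_*` theorems.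
-/

noncomputable section

open scoped Manifold ContDiff Topology ENNReal
open TopologicalSpace (Opens)

namespace Summit.HodgeConjecture.HodgeConjecture.Cruxes.VisibleFraction.PhantomLevels

open Literature.AlgebraicGeometry.Motives (SchemeOver)
open Literature.AlgebraicGeometry.HodgeTheory
open Literature.Geometry.Kaehler (MForm IsSmoothForm)
open Literature.Geometry.GeometricMeasureTheory (Current)
open Summit.HodgeConjecture.HodgeConjecture.Theses.GmtVisibleFractionBootstrap

/-! ## §1 The stub statements -/

/-- **Stub 1 statement — generalized Wirtinger lower bound.** For every setup there is `κ > 0` (the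
normalising constant between the tree's `size`, wedge and comass conventions, deliberately existential)
such that every integral cycle representing `k · PD[α]` of a strictly positive rational datum has mass
`≥ κ k |α|`. This is conjunct (i) of `Birth.MinimalMassAsymptotics` (shared content with `Lines/birth.lean`).
[cite: Lawson1975MinimalVarieties, §5 Thm. 5.13 and Cor. 5.14] [cite: HarveyKnapp1974, §1]
[cite: Federer1969, 5.4.19] -/
def WirtingerLowerBound : Prop :=
  ∀ (n : ℕ) (X : SchemeOver ℂ) (A : HodgeModel n X) [Fact (Module.finrank ℝ A.model = 2 * n)]
    [MeasurableSpace A.model] [BorelSpace A.model] (V : Type) [NormedAddCommGroup V]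
    [InnerProductSpace ℝ V] [FiniteDimensional ℝ V] [MeasurableSpace V] [BorelSpace V]
    (S : KaehlerEmbedding A V) (p q : ℕ) (hpq : p + q = n), 1 ≤ p → p ≤ q →
    ∃ κ : ℝ, 0 < κ ∧
      ∀ (c₀ : complexBetti X (2 * p)) (α : MForm 𝓘(ℝ, A.model) A.carrier ℝ (2 * p)),
        IsRationalClass c₀ → A.FormRepresents (2 * p) α c₀ → IsSmoothForm α →
          IsStrictlyPositiveForm p α →
            ∀ (k : ℕ) (T : Current (⊤ : Opens V) (2 * q)), S.Represents hpq α k T →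
              ENNReal.ofReal (κ * k * S.size hpq α) ≤ T.mass

/-- **Stub 2 statement — visibility at effective levels (structure of calibrated integral cycles).** If the
class `k · PD[α]` is represented by an integral cycle carried by `ι(X)` which is openly holomorphic
`‖·‖`-a.e., then EVERY mass-minimizer in that class is openly holomorphic `‖·‖`-a.e.: the holomorphic
representative is calibrated by `ω^q/q!`, so each minimizer has the calibrated mass, is calibrated a.e., and
a closed integral current calibrated by a Kähler power is a positive holomorphic chain whose singular set
is `‖T‖`-null. A theorem in print (any `α`, any `k`). [cite: King1971, Thm. 5.2.1]
[cite: HarveyShiffman1974, Thm. 2.1] [cite: Federer1969, 5.4.19] -/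
def EffectiveLevelVisibility : Prop :=
  ∀ (n : ℕ) (X : SchemeOver ℂ) (A : HodgeModel n X) [Fact (Module.finrank ℝ A.model = 2 * n)]
    [MeasurableSpace A.model] [BorelSpace A.model] (V : Type) [NormedAddCommGroup V]
    [InnerProductSpace ℝ V] [FiniteDimensional ℝ V] [MeasurableSpace V] [BorelSpace V]
    (S : KaehlerEmbedding A V) (p q : ℕ) (hpq : p + q = n)
    (α : MForm 𝓘(ℝ, A.model) A.carrier ℝ (2 * p)) (k : ℕ),
    (∃ T₀ : Current (⊤ : Opens V) (2 * q),
        S.Represents hpq α k T₀ ∧ T₀.variation (S.holLocus p T₀) = T₀.mass) →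
      ∀ T : Current (⊤ : Opens V) (2 * q), S.IsMassMinimizing hpq α k T →
        T.variation (S.holLocus p T) = T.mass

/-- **Stub 3 statement — visibility at phantom levels (THE BET).** For every setup there is `c > 0` such
that for every strictly positive rational datum and all large `k`: IF the class `k · PD[α]` has NO
openly-holomorphic integral representative (a phantom level — under HC for the class these are the
Kollár-type levels `k c₀ ∉ ℤ-span of algebraic classes`), every mass-minimizer still carries
`≥ c · k · |α|` of variation on its openly-holomorphic locus. [cite: Lawson1975MinimalVarieties, Conj. 5.15
and p. 206] [cite: Kollar1992TrentoLemma, p. 134] [cite: SouleVoisin2005, §2] -/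
def PhantomLevelVisibility : Prop :=
  ∀ (n : ℕ) (X : SchemeOver ℂ) (A : HodgeModel n X) [Fact (Module.finrank ℝ A.model = 2 * n)]
    [MeasurableSpace A.model] [BorelSpace A.model] (V : Type) [NormedAddCommGroup V]
    [InnerProductSpace ℝ V] [FiniteDimensional ℝ V] [MeasurableSpace V] [BorelSpace V]
    (S : KaehlerEmbedding A V) (p q : ℕ) (hpq : p + q = n), 1 ≤ p → p ≤ q →
    ∃ c : ℝ, 0 < c ∧
      ∀ (c₀ : complexBetti X (2 * p)) (α : MForm 𝓘(ℝ, A.model) A.carrier ℝ (2 * p)),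
        IsRationalClass c₀ → A.FormRepresents (2 * p) α c₀ → IsSmoothForm α →
          IsStrictlyPositiveForm p α →
            ∃ k₀ : ℕ, ∀ k : ℕ, k₀ ≤ k →
              (¬ ∃ T₀ : Current (⊤ : Opens V) (2 * q),
                  S.Represents hpq α k T₀ ∧ T₀.variation (S.holLocus p T₀) = T₀.mass) →
                ∀ T : Current (⊤ : Opens V) (2 * q), S.IsMassMinimizing hpq α k T →
                  ENNReal.ofReal (c * k * S.size hpq α) ≤ T.variation (S.holLocus p T)

/-! ## §2 The stubs (the ONLY `sorry`s of this file) -/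

/-- STUB 1 (registered): `WirtingerLowerBound` — generalized Wirtinger inequality for integral cycles
carried by `ι(X)`, in the tree's currency. [cite: Lawson1975MinimalVarieties, Thm. 5.13, Cor. 5.14] -/
theorem stub_wirtingerLowerBound : WirtingerLowerBound := by
  sorry

/-- STUB 2 (registered): `EffectiveLevelVisibility` — at a level with a holomorphic representative every
minimizer is a positive holomorphic chain (King / Harvey–Shiffman). [cite: HarveyShiffman1974, Thm. 2.1] -/
theorem stub_effectiveLevelVisibility : EffectiveLevelVisibility := by
  sorry

/-- STUB 3 (registered, THE BET): `PhantomLevelVisibility` — minimizers of a strictly positive rational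
class with no holomorphic representative keep a `c`-fraction of `k|α|` on the openly-holomorphic locus.
[cite: Lawson1975MinimalVarieties, Conj. 5.15] -/
theorem stub_phantomLevelVisibility : PhantomLevelVisibility := by
  sorry

/-! ### Name-keyed aliases (the skeleton audit admits a hypothesis of `VisibleFraction_of` iff the head
constant of its type has the short name of a declared stub) -/
namespace Registered

/-- Alias of `WirtingerLowerBound` keyed by the registered stub name. -/
abbrev stub_wirtingerLowerBound : Prop := WirtingerLowerBound
/-- Alias of `EffectiveLevelVisibility` keyed by the registered stub name. -/
abbrev stub_effectiveLevelVisibility : Prop := EffectiveLevelVisibility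
/-- Alias of `PhantomLevelVisibility` keyed by the registered stub name. -/
abbrev stub_phantomLevelVisibility : Prop := PhantomLevelVisibility

end Registered

/-! ## §3 Composition (no `sorry` below this line) -/

/-- **The three stubs imply the crux, BY NAME.** `κ` from stub 1, `c` from stub 3; the crux constant is
`min κ c`; for a datum take `k₀` from stub 3; at a level `k ≥ k₀` either the class has an
openly-holomorphic representative — then stub 2 makes the minimizer fully visible and stub 1 bounds its
mass below by `κ k |α|` — or it has none, and stub 3 applies. (If `k |α| ≤ 0` every claim reads
`0 ≤ …`.) -/
theorem VisibleFraction_of (hW : Registered.stub_wirtingerLowerBound)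
    (hE : Registered.stub_effectiveLevelVisibility)
    (hP : Registered.stub_phantomLevelVisibility) : VisibleFraction := by
  intro n X A _ _ _ V _ _ _ _ _ S p q hpq hp hpq'
  obtain ⟨κ, hκ, hκW⟩ := hW n X A V S p q hpq hp hpq'
  obtain ⟨c, hc, hcP⟩ := hP n X A V S p q hpq hp hpq'
  refine ⟨min κ c, lt_min hκ hc, fun c₀ α hrat hrep hsm hpos => ?_⟩
  obtain ⟨k₀, hk₀⟩ := hcP c₀ α hrat hrep hsm hpos
  refine ⟨k₀, fun k hk T hT => ?_⟩
  -- monotonicity of the crux inequality in the constant, with the sign of `k |α|` handled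
  have hmono : ∀ d : ℝ, min κ c ≤ d →
      ENNReal.ofReal (min κ c * k * S.size hpq α) ≤ ENNReal.ofReal (d * k * S.size hpq α) := by
    intro d hd
    rcases le_or_gt ((k : ℝ) * S.size hpq α) 0 with hks | hks
    · have hnp : min κ c * k * S.size hpq α ≤ 0 := by
        rw [mul_assoc]
        exact mul_nonpos_of_nonneg_of_nonpos (lt_min hκ hc).le hks
      rw [ENNReal.ofReal_of_nonpos hnp]
      exact bot_le
    · apply ENNReal.ofReal_le_ofReal
      rw [mul_assoc, mul_assoc]
      exact mul_le_mul_of_nonneg_right hd hks.le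
  by_cases hEff : ∃ T₀ : Current (⊤ : Opens V) (2 * q),
      S.Represents hpq α k T₀ ∧ T₀.variation (S.holLocus p T₀) = T₀.mass
  · have hfull : T.variation (S.holLocus p T) = T.mass :=
      hE n X A V S p q hpq α k hEff T hT
    rw [hfull]
    exact (hmono κ (min_le_left κ c)).trans (hκW c₀ α hrat hrep hsm hpos k T hT.1)
  · exact (hmono c (min_le_right κ c)).trans (hk₀ k hk hEff T hT)

/-- Wiring check: the registered stubs feed the composition as stated (definitional unfolding only). -/
example : VisibleFraction :=
  VisibleFraction_of stub_wirtingerLowerBound stub_effectiveLevelVisibility stub_phantomLevelVisibility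

/-! ## §4 Converse bookkeeping (proved): where the bet sits relative to the crux -/

/-- Stub 3 is the crux restricted to phantom levels (drop the level hypothesis): the BET is implied by the
crux, so modulo the two theorems-in-print (stubs 1–2) it is exactly the open content of the crux. -/
theorem phantomLevelVisibility_of_visibleFraction (h : VisibleFraction) : PhantomLevelVisibility := by
  intro n X A _ _ _ V _ _ _ _ _ S p q hpq hp hpq'
  obtain ⟨c, hc, hcV⟩ := h n X A V S p q hpq hp hpq'
  refine ⟨c, hc, fun c₀ α hrat hrep hsm hpos => ?_⟩
  obtain ⟨k₀, hk₀⟩ := hcV c₀ α hrat hrep hsm hpos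
  exact ⟨k₀, fun k hk _ T hT => hk₀ k hk T hT⟩

end Summit.HodgeConjecture.HodgeConjecture.Cruxes.VisibleFraction.PhantomLevels

end
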